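import Mathlib
import HarnessLib
import Summits.CriticalPhenomena.CardyFormulaZ2.Theses.CardySusyWard
import Literature.Probability.Percolation.Percolation
import Literature.Probability.LatticeModels.ThermodynamicLimit

/-!
# Sketch (crux-ideate, ideator 3, round 1) — first lemmas of three lines on
`CardySusyWard.ParafermionPrecompact` (stmt-CriticalPhenomena-11293)

All three ideas target the REPAIRED content C′ (`Disproof.ParafermionPrecompactRepaired`,
edge guards); as typed the crux is `¬ ParafermionBulkNondegenerate`
(`Disproof.parafermionPrecompact_iff_not_bulkNondegenerate`).

* Card `ip12-boundary-scale`: `HalfPlaneOneArmSharp` — the sharp half-plane one-arm law on `ℤ²`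
  from Ikhlef–Ponsaing's exact strip formula (arXiv:1202.5476 Prop. 4.7/4.9) + RSW.
* Card `vertex-sum-projects-staggered-mode`: `DiscreteCauchyLipschitz` — interior Lipschitz
  estimate for Duffin-holomorphic functions on `ℤ[i]` with an `ℓ^∞` defect.
* Card `mirror-reversal-phase-lock`: `MirrorPhaseIdentity` — exact conjugation identity of the
  spin-`σ` passage observable under a reflection symmetry of the discrete Dobrushin datum.
-/

noncomputable section

namespace Summit.CriticalPhenomena.CardyFormulaZ2.Cruxes.ParafermionPrecompact.SketchIdeator3

open Literature.Probability.LatticeModels Literature.Probability.Percolation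
open MeasureTheory Filter Set
open scoped Topology

/-! ### Card 1 — sharp boundary scale from the combinatorial point -/

/-- Half-box one-arm event from the boundary point `0` of critical bond percolation on `ℤ²`:
`0` is joined by an open path inside the upper half-box `{z ∈ box 2 n | 0 ≤ z 1}` to the top
side `{z 1 = n}` (= Ikhlef–Ponsaing's boundary passage event `P_b` truncated to a box). -/
def halfBoxArm (n : ℕ) : Set (BondConfig (Site 2)) :=
  {ω | ∃ y : Site 2, y 1 = n ∧
    ω ∈ openConnIn ((↑(box 2 n) : Set (Site 2)) ∩ {z : Site 2 | 0 ≤ z 1}) 0 y}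

/-- FIRST LEMMA (card 1). The half-plane one-arm probability of bond percolation on `ℤ²` at
`p = 1/2` is of exact order `n^{-1/3}`: upper AND lower bounds up to constants, no `o(1)` in the
exponent. Source: the exact finite-size boundary passage probability
`P_b^{(L)} = A_V(L) A_V(L+2) / N_8(L+1)^2 ∼ C L^{-1/3}` of the wired/free strip of odd width `L`
(Ikhlef–Ponsaing 2012, Prop. 4.7 and 4.9), transferred to the half-box by RSW/FKG gluing. -/
def HalfPlaneOneArmSharp : Prop :=
  ∃ c C : ℝ, 0 < c ∧ ∀ n : ℕ, 1 ≤ n →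
    c * (n : ℝ) ^ (-(1:ℝ) / 3) ≤ (bondPercolation (zdGraph 2) half).real (halfBoxArm n) ∧
    (bondPercolation (zdGraph 2) half).real (halfBoxArm n) ≤ C * (n : ℝ) ^ (-(1:ℝ) / 3)

/-! ### Card 2 — interior regularity of almost-Duffin-holomorphic functions -/

/-- Duffin's discrete `∂̄` on the Gaussian integers (one unit square with lower-left corner `p`):
`u(p+1+i) - u(p) + i (u(p+i) - u(p+1))`; it vanishes iff
`(u(p+1+i)-u(p))/(1+i) = (u(p+i)-u(p+1))/(i-1)` (Duffin 1956). Under the identification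
`ℤ[i] ≃ ℤ² ∪ (ℤ²)^*` (sites = even parity, faces = odd parity) this is the rhombus
Cauchy–Riemann equation of the double square lattice (Chelkak–Smirnov 2011, 2012). -/
def duffinDbar (u : ℤ × ℤ → ℂ) (p : ℤ × ℤ) : ℂ :=
  u (p + (1, 1)) - u p + Complex.I * (u (p + (0, 1)) - u (p + (1, 0)))

/-- FIRST LEMMA (card 2). Interior Lipschitz estimate with defect: if `‖u‖ ≤ M` and
`‖∂̄ u‖ ≤ η` on the box of radius `4R`, then on the box of radius `R`, for points of the SAME
parity (the kernel contains the two sublattice constants), `‖u p - u q‖ ≤ C (|p-q|/R) M + C R η`.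
The `η`-term is first-order (discrete Cauchy–Pompeiu with Duffin's kernel `K ≍ 1/|p|`), not the
cruder `R² η` of the Laplacian route — this is what makes the `O((δ/d)²)` co-closedness defect of
the holomorphic component negligible (`R η = O(δ)`). -/
def DiscreteCauchyLipschitz : Prop :=
  ∃ C : ℝ, 0 < C ∧ ∀ (u : ℤ × ℤ → ℂ) (R : ℕ) (M η : ℝ), 1 ≤ R →
    (∀ p : ℤ × ℤ, |p.1| ≤ 4 * (R : ℤ) → |p.2| ≤ 4 * (R : ℤ) → ‖u p‖ ≤ M) →
    (∀ p : ℤ × ℤ, |p.1| ≤ 4 * (R : ℤ) → |p.2| ≤ 4 * (R : ℤ) → ‖duffinDbar u p‖ ≤ η) →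
    ∀ p q : ℤ × ℤ, |p.1| ≤ R → |p.2| ≤ R → |q.1| ≤ R → |q.2| ≤ R →
      (2 : ℤ) ∣ (p.1 + p.2 - (q.1 + q.2)) →
      ‖u p - u q‖ ≤ C * ((|((p.1 - q.1 : ℤ) : ℝ)| + |((p.2 - q.2 : ℤ) : ℝ)|) / R) * M + C * R * η

/-! ### Card 3 — mirror/reversal phase lock -/

/-- The reflection `(x, y) ↦ (x, -y)` of `ℤ²`. -/
def reflectSite (v : Site 2) : Site 2 := Function.update v 1 (-(v 1))

/-- FIRST LEMMA (card 3). For an admissible discrete Dobrushin datum symmetric under complex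
conjugation (domain and both arcs; then conjugation swaps the two `A`–`B` edges and maps the
exploration path to the REVERSED exploration path of the reflected configuration), the spin-`σ`
passage observable satisfies the exact conjugation identity
`F(z̄) = e^{iθ} · conj (F z)` with a deterministic phase `θ = -σ W_tot` (total turning of the
interface, fixed by the Umlaufsatz). On the symmetry axis this pins the phase of `F` exactly —
the lattice-exact ancestor of the asymptotic phase lock near flat boundary pieces. -/
def MirrorPhaseIdentity : Prop :=
  ∀ (E : DiscreteDobrushin), E.IsZdAdmissible → 0 < E.δ →
    (∀ w : ℂ, w ∈ E.Ω ↔ (starRingEnd ℂ) w ∈ E.Ω) →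
    (∀ w : ℂ, w ∈ E.arcA ↔ (starRingEnd ℂ) w ∈ E.arcA) →
    (∀ w : ℂ, w ∈ E.arcB ↔ (starRingEnd ℂ) w ∈ E.arcB) →
    ∀ σ : ℝ, ∃ θ : ℝ, ∀ z : MedialVertex, z ∈ (zdGraph 2).edgeSet →
      (∫ ω, passageSum (medialExploration E ω) E.δ σ (Sym2.map reflectSite z)
          ∂(bondPercolation (zdGraph 2) half)) =
        Complex.exp (Complex.I * θ) * (starRingEnd ℂ)
          (∫ ω, passageSum (medialExploration E ω) E.δ σ z ∂(bondPercolation (zdGraph 2) half))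

/-! ### Sanity: the three Props elaborate and the crux decl is in scope -/

example : Prop := HalfPlaneOneArmSharp ∧ DiscreteCauchyLipschitz ∧ MirrorPhaseIdentity
example : Prop := Theses.CardySusyWard.ParafermionPrecompact

end Summit.CriticalPhenomena.CardyFormulaZ2.Cruxes.ParafermionPrecompact.SketchIdeator3

end
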